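import Summits.BirchSwinnertonDyer.Rank1Residual.Additive.TwistPartnerForced
import Summits.BirchSwinnertonDyer.Rank1Residual.Additive.TwistPartnerRigidityNewform
import HarnessLib

/-!
# THE REDUCTION: `CensusX43.HasOrdinaryTwistPartner χ f ↔ U_p[·]⁺_f = 0 ∧ ∃ ã unit, Φ_{f,χ,ã} bounded`;
# on an additive row the E-normalised tame branch from ONE boundedness statement (cell `b2b-bsdres`,
# sub-cell additive-p2 = X3♯(G-ord) / X4♯(G-ord), gen 23; sequel of `TwistPartnerForced.lean`)

HONEST FRAMING (cell `b2b-bsdres`, run/shared/lean/b2b/bsd-rank1-residual/, verbatim in every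
file): the goal of the cell is to DELETE the COMBINATION-SHAPED residual classes of the
Birch–Swinnerton-Dyer formula for ALL analytic-rank `≤ 1` elliptic curves over `ℚ` — "full BSD
formula for every rank `≤ 1` curve in class `C`" assembled STRICTLY from published theorems — so
that the rank-`≤ 1` remainder becomes exactly the CONSTRUCTION-SHAPED classes, which are TYPED
(missing-input `Prop`s), NOT attempted. This is not "finishing BSD". Sub-cell additive-p2: the
classes X3♯(G-ord) / X4♯(G-ord) are CONSTRUCTION-SHAPED and stay so; labels / RESIDUAL-MAP marks
UNCHANGED; nothing is booked. THEOREMS ONLY (no definition, no named fact, no conjecture node).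

## What

`TwistPartnerForced.lean` wrote down the forced partner `Φ = forced χ x ã` — `1`-periodic and
solving `Φ(s) = S(s) + (ã/p)Φ(ps)` on all of `ℚ` (`S = source χ x = (χ(−1)/p)·τ_χ x`), for any
`1`-periodic `x` and unit `ã`. Here:

* §1 `sum_eq_mul_of_recursion`, `twist_inv_eq_of_recursion` — CONVERSELY a `1`-periodic solution
  of the recursion is an ordinary twist partner as soon as `U_p x = 0` (`∑_d x(· + d/p) = 0`) and
  `χ ≠ 1`: `∑_d Φ(s + d/p) = ãΦ(ps)` (since `∑_d S(s + d/p) = 0`) and `τ_{χ⁻¹}Φ = x`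
  (`τ_{χ⁻¹}τ_χ x = pχ(−1)x` by cc-typer-1's `CensusX43.twist_twist_inv` run for `χ⁻¹` together with
  `U_p x = 0`); hence **`forced_isPartner`** and **`eq_forced_of_partner`** (every partner IS the
  forced one, `TwistPartner.partner_unique`);
* §2 `exists_forall_norm_le_norm_of_bounded` (a bounded `ℚ_p`-valued function attains its sup: the
  non-zero norms are `p^{−v}`, `v ∈ ℤ` bounded below) and THE REDUCTION
  **`hasOrdinaryTwistPartner_iff_bounded_forced`**: for a newform symbol `x = [·]⁺_f` and `χ ≠ 1`,
  `CensusX43.HasOrdinaryTwistPartner χ f ↔ (∀ s, ∑_d [s + d/p]⁺_f = 0) ∧ ∃ ã, ‖ã‖ = 1 ∧ forced χ [·]⁺_f ã`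
  is bounded — the `∃` over functions `ℚ → ℚ_p` of cc-typer-2's typed input
  (`CensusX43ValueModule.lean`; in print the symbol of Delbourgo's `f̃ = f_E ⊗ ε̄`) is GONE;
* §3 curve level: at an ADDITIVE prime of `E = W` (`U_p f_E = 0` automatic,
  `sum_cast_ratPlusSymbol_add_div_eq_zero_of_addv`) **`hasOrdinaryTwistPartner_iff_of_addv`**:
  `HasOrdinaryTwistPartner χ f_E ↔ ∃ ã, ‖ã‖ = 1 ∧ forced χ [·]⁺_{f_E} ã` bounded; and
  **`exists_isTameBranchOf_of_bounded_forced`**: ONE unit `ã` with `Φ_{f_E,χ,ã}` bounded PRODUCES the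
  E-normalised tame branch `IsTameBranchOf f_E p (ι∘χ) ã B` with the integrality transfer
  (cc-typer-2's bridge `exists_isTameBranchOf_of_twistPartnerData` run on the forced partner). On the
  defect-3/4/6 rows of X3♯(G-ord)/X4♯(G-ord) — no twist curve, no engine (X42-WINDOW.md §0: "13
  Gord_e346 window rows NOT run") — the analytic object of `TameBranchRatCharEqAt` /
  `TameBranchRatDvdAt` (A227's Kato half) / `CharLamLeAt` is therefore inhabited by ONE boundedness
  statement about ONE explicit function of `E`'s own modular symbols (in print: Manin–Drinfeld for
  `f̃`, Atkin–Li 1978 §3 + Delbourgo 1998 §1.5), CHECKABLE per pair to any finite level, with the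
  unit DETECTED by boundedness (`CensusX43.eigenvalue_unique_of_ratPlusSymbol_zero_ne_zero`,
  `TwistPartnerRigidityNewform.lean`). ENGINE RECIPE for the census's owed Gord_e346 column:
  `μ(a + pⁿℤ_p) = ã⁻ⁿχ̄(a)·forced(a/pⁿ)` with `forced(a/pⁿ)` = the tower formula
  `TwistPartner.apply_div_pow_eq_sum` (`TwistPartnerRigidity.lean`).

* §4 the ENGINE written out: `forced_apply_div_pow_eq_sum` (the forced partner on the tower) and
  `twistPartnerMeasure_forced_succ` (the tame-branch measure of cc-typer-2's bridge on the forced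
  partner, level by level, as a finite sum of `χ`-twisted values of `x`).

References: B. Mazur, J. Tate, J. Teitelbaum, Invent. Math. 84 (1986) §I.8, §I.10 (10.1)–(10.2),
§I.14 (14.3) [MazurTateTeitelbaum1986Invent]; A. O. L. Atkin, W. Li, Invent. Math. 48 (1978) §3
[AtkinLi1978]; D. Delbourgo, Compositio Math. 113 (1998) §1.5–1.6 [Delbourgo1998];
ttrl/bsd-formula-census/X42-WINDOW.md (sha256 a10a1709…; EVIDENCE).
-/

noncomputable section

open scoped Classical MatrixGroups ModularForm

open CongruenceSubgroup

namespace Summit.BirchSwinnertonDyer.Rank1Residual.Additive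

open Literature.NumberTheory.EllipticCurves Literature.NumberTheory.EllipticCurves.ModularForms
  Literature.NumberTheory.EllipticCurves.Rank1Residual

namespace TwistPartner

/-! ### §1 Conversely: a periodic solution of the recursion is a partner once `U_p x = 0` -/

section Converse

variable {p : ℕ} [hp : Fact p.Prime] {χ : MulChar (ZMod p) ℚ_[p]} {x Φ : ℚ → ℚ_[p]} {ã : ℚ_[p]}

/-- `∑_d S(s + d/p) = 0` from `U_p x = 0`. [folklore] -/
theorem sum_source_add_div_eq_zero (hU0 : ∀ s, ∑ d : ZMod p, x (s + (d.val : ℚ) / p) = 0)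
    (s : ℚ) : ∑ d : ZMod p, source χ x (s + (d.val : ℚ) / p) = 0 := by
  simp only [source, CensusX43.twist, Finset.mul_sum]
  rw [Finset.sum_comm]
  refine Finset.sum_eq_zero fun b _ ↦ ?_
  have h := hU0 (s + (b.val : ℚ) / p)
  have h' : ∑ d : ZMod p, x (s + (d.val : ℚ) / p + (b.val : ℚ) / p) = 0 := by
    rw [← h]
    exact Finset.sum_congr rfl fun d _ ↦ by rw [add_right_comm]
  rw [← Finset.mul_sum, ← Finset.mul_sum, h', mul_zero, mul_zero]

/-- **`U_p`-EIGEN from the recursion**: a `1`-periodic solution of `Φ = S + (ã/p)Φ(p·)` satisfies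
`∑_d Φ(s + d/p) = ã·Φ(ps)` once `U_p x = 0`. [cite: MazurTateTeitelbaum1986Invent, §I.10 (10.2)] -/
theorem sum_eq_mul_of_recursion (hper : ∀ s, Φ (s + 1) = Φ s)
    (hrec : ∀ s, Φ s = source χ x s + ã / p * Φ (p * s))
    (hU0 : ∀ s, ∑ d : ZMod p, x (s + (d.val : ℚ) / p) = 0) (s : ℚ) :
    ∑ d : ZMod p, Φ (s + (d.val : ℚ) / p) = ã * Φ (p * s) := by
  have hp0 : (p : ℚ) ≠ 0 := Nat.cast_ne_zero.mpr hp.out.ne_zero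
  have hp0' : (p : ℚ_[p]) ≠ 0 := Nat.cast_ne_zero.mpr hp.out.ne_zero
  have h1 : ∀ d : ZMod p, Φ (s + (d.val : ℚ) / p) =
      source χ x (s + (d.val : ℚ) / p) + ã / p * Φ (p * s) := by
    intro d
    rw [hrec, mul_add, mul_div_cancel₀ _ hp0, CensusX43.periodic_natCast hper]
  simp_rw [h1]
  rw [Finset.sum_add_distrib, sum_source_add_div_eq_zero hU0, zero_add, Finset.sum_const,
    Finset.card_univ, ZMod.card, nsmul_eq_mul]
  field_simp

/-- **The `χ⁻¹`-twist of a solution of the recursion is `x`** once `U_p x = 0` (`χ ≠ 1`, `x`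
`1`-periodic): `τ_{χ⁻¹}Φ = τ_{χ⁻¹}S = (χ(−1)/p)τ_{χ⁻¹}τ_χ x = x` (`CensusX43.twist_twist_inv` for `χ⁻¹`).
[cite: MazurTateTeitelbaum1986Invent, §I.8] -/
theorem twist_inv_eq_of_recursion (hχ : χ ≠ 1) (hperx : ∀ s, x (s + 1) = x s)
    (hper : ∀ s, Φ (s + 1) = Φ s) (hrec : ∀ s, Φ s = source χ x s + ã / p * Φ (p * s))
    (hU0 : ∀ s, ∑ d : ZMod p, x (s + (d.val : ℚ) / p) = 0) (s : ℚ) :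
    CensusX43.twist χ⁻¹ Φ s = x s := by
  have hp0 : (p : ℚ) ≠ 0 := Nat.cast_ne_zero.mpr hp.out.ne_zero
  have hp0' : (p : ℚ_[p]) ≠ 0 := Nat.cast_ne_zero.mpr hp.out.ne_zero
  have hχi : χ⁻¹ ≠ 1 := fun h1 ↦ hχ (inv_eq_one.mp h1)
  -- the stabilising tail twists to zero
  have h1 : CensusX43.twist χ⁻¹ Φ s = CensusX43.twist χ⁻¹ (source χ x) s := by
    simp only [CensusX43.twist]
    have h2 : ∀ c : ZMod p, χ⁻¹ c * Φ (s + (c.val : ℚ) / p) =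
        χ⁻¹ c * source χ x (s + (c.val : ℚ) / p) + χ⁻¹ c * (ã / p * Φ (p * s)) := by
      intro c
      rw [hrec (s + (c.val : ℚ) / p), mul_add (p : ℚ), mul_div_cancel₀ _ hp0,
        CensusX43.periodic_natCast hper, mul_add]
    simp_rw [h2]
    rw [Finset.sum_add_distrib, ← Finset.sum_mul, MulChar.sum_eq_zero_of_ne_one hχi, zero_mul,
      add_zero]
  -- `τ_{χ⁻¹} τ_χ x = p χ(−1) x`
  have h3 : CensusX43.twist χ⁻¹ (source χ x) s = x s := by
    simp only [CensusX43.twist, source]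
    have h4 := CensusX43.twist_twist_inv χ⁻¹ hχi hperx s
    rw [inv_inv, hU0, mul_zero, zero_add, inv_apply_neg_one] at h4
    have h5 : ∑ b : ZMod p, χ⁻¹ b * (χ (-1) / p * ∑ c : ZMod p, χ c * x (s + (b.val : ℚ) / p + (c.val : ℚ) / p))
        = χ (-1) / p * ∑ b : ZMod p, χ⁻¹ b * ∑ c : ZMod p, χ c * x (s + (b.val : ℚ) / p + (c.val : ℚ) / p) := by
      rw [Finset.mul_sum]
      exact Finset.sum_congr rfl fun b _ ↦ by ring
    rw [h5, h4]
    have h6 := apply_neg_one_mul_self χ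
    rw [show χ (-1) / (p : ℚ_[p]) * ((p : ℚ_[p]) * χ (-1) * x s) =
      (χ (-1) * χ (-1)) * ((p : ℚ_[p]) / p) * x s by ring, h6, div_self hp0', one_mul, one_mul]
  rw [h1, h3]

/-- **THE FORCED PARTNER IS A PARTNER** once `U_p x = 0`: `1`-periodic, `x = τ_{χ⁻¹}Φ_{x,χ,ã}`,
`∑_d Φ(· + d/p) = ãΦ(p·)` (`χ ≠ 1`, `‖ã‖ = 1`, `x` `1`-periodic). Boundedness is NOT claimed — it is
the one remaining content of the typed input. [cite: MazurTateTeitelbaum1986Invent, §I.10] -/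
theorem forced_isPartner (hχ : χ ≠ 1) (hã : ‖ã‖ = 1) (hperx : ∀ s, x (s + 1) = x s)
    (hU0 : ∀ s, ∑ d : ZMod p, x (s + (d.val : ℚ) / p) = 0) :
    (∀ s, forced χ x ã (s + 1) = forced χ x ã s) ∧
      (∀ s, x s = CensusX43.twist χ⁻¹ (forced χ x ã) s) ∧
      (∀ s, ∑ d : ZMod p, forced χ x ã (s + (d.val : ℚ) / p) = ã * forced χ x ã (p * s)) :=
  ⟨forced_add_one hperx,
    fun s ↦ (twist_inv_eq_of_recursion hχ hperx (forced_add_one hperx)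
      (forced_eq_source_add_mul hã hperx) hU0 s).symm,
    sum_eq_mul_of_recursion (forced_add_one hperx) (forced_eq_source_add_mul hã hperx) hU0⟩

/-- **Every partner IS the forced partner** (uniqueness, `TwistPartner.partner_unique`). [folklore] -/
theorem eq_forced_of_partner (hχ : χ ≠ 1) (hã : ‖ã‖ = 1) (hperx : ∀ s, x (s + 1) = x s)
    (hper : ∀ s, Φ (s + 1) = Φ s) (hx : ∀ s, x s = CensusX43.twist χ⁻¹ Φ s)
    (hU : ∀ s, ∑ d : ZMod p, Φ (s + (d.val : ℚ) / p) = ã * Φ (p * s)) : Φ = forced χ x ã := by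
  have hU0 : ∀ s, ∑ d : ZMod p, x (s + (d.val : ℚ) / p) = 0 :=
    sum_apply_add_div_eq_zero hχ hper hx hU
  obtain ⟨hper', hx', hU'⟩ := forced_isPartner hχ hã hperx hU0
  exact partner_unique hχ hã hper' hx' hU' hper hx hU

end Converse

/-! ### §2 The reduction of the typed input to boundedness of the forced partner -/

section Reduction

variable {p : ℕ} [hp : Fact p.Prime]

/-- **A bounded `ℚ_p`-valued function attains its sup norm** (the non-zero norms are `p^{−v}` with
`v ∈ ℤ` bounded below, so a least `v` is attained). [folklore] -/
theorem exists_forall_norm_le_norm_of_bounded {g : ℚ → ℚ_[p]} {C : ℝ} (hC : ∀ s, ‖g s‖ ≤ C) :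
    ∃ s₁, ∀ s, ‖g s‖ ≤ ‖g s₁‖ := by
  by_cases hall : ∀ s, g s = 0
  · exact ⟨0, fun s ↦ by rw [hall s, norm_zero]; exact norm_nonneg _⟩
  obtain ⟨s₀, hs₀⟩ := not_forall.mp hall
  -- valuations of the non-zero values are bounded below
  have hp1 : (1 : ℝ) < p := by exact_mod_cast hp.out.one_lt
  obtain ⟨B, hB⟩ : ∃ B : ℤ, C < (p : ℝ) ^ B := by
    obtain ⟨n, hn⟩ := pow_unbounded_of_one_lt C hp1
    exact ⟨n, by exact_mod_cast hn⟩
  have hval : ∀ s, g s ≠ 0 → -B ≤ (g s).valuation := by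
    intro s hs
    by_contra hlt
    push Not at hlt
    have h1 : ‖g s‖ = (p : ℝ) ^ (-(g s).valuation) := Padic.norm_eq_zpow_neg_valuation hs
    have h2 : (p : ℝ) ^ B ≤ (p : ℝ) ^ (-(g s).valuation) :=
      zpow_le_zpow_right₀ hp1.le (by omega)
    linarith [hC s]
  -- the least attained valuation
  let S : Set ℤ := {v | ∃ s, g s ≠ 0 ∧ (g s).valuation = v}
  have hSne : S.Nonempty := ⟨_, s₀, hs₀, rfl⟩
  have hSbdd : BddBelow S := ⟨-B, fun v ⟨s, hs, hv⟩ ↦ hv ▸ hval s hs⟩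
  obtain ⟨s₁, hs₁, hv₁⟩ : sInf S ∈ S := Int.csInf_mem hSne hSbdd
  refine ⟨s₁, fun s ↦ ?_⟩
  by_cases hs : g s = 0
  · rw [hs, norm_zero]; exact norm_nonneg _
  have hle : sInf S ≤ (g s).valuation := csInf_le hSbdd ⟨s, hs, rfl⟩
  rw [Padic.norm_eq_zpow_neg_valuation hs, Padic.norm_eq_zpow_neg_valuation hs₁, hv₁]
  exact zpow_le_zpow_right₀ hp1.le (by omega)

variable {N : ℕ} [NeZero N] {f : CuspForm (Gamma0 N) 2} {χ : MulChar (ZMod p) ℚ_[p]}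

/-- **THE REDUCTION.** For a newform symbol `[·]⁺_f` and `χ ≠ 1`:
`CensusX43.HasOrdinaryTwistPartner χ f ↔ (∀ s, ∑_{d mod p} [s + d/p]⁺_f = 0) ∧ ∃ ã, ‖ã‖ = 1 ∧`
the FORCED partner `Φ_{f,χ,ã} = forced χ [·]⁺_f ã` is bounded. (→: the given partner forces
`U_p[·]⁺_f = 0` and IS the forced one, so the forced one is bounded; ←: the forced one is a partner
and a bounded function attains its sup.) cc-typer-2's existential over functions `ℚ → ℚ_p` is thus
ONE number `ã` and ONE boundedness claim about an explicit function of `f`'s own symbols.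
[cite: MazurTateTeitelbaum1986Invent, §I.10] [cite: Delbourgo1998, §1.5] -/
theorem hasOrdinaryTwistPartner_iff_bounded_forced (hχ : χ ≠ 1) :
    CensusX43.HasOrdinaryTwistPartner χ f ↔
      (∀ s, ∑ d : ZMod p, ratPlusSymbol f (s + (d.val : ℚ) / p) = 0) ∧
        ∃ ã : ℚ_[p], ‖ã‖ = 1 ∧ ∃ C : ℝ, ∀ s,
          ‖forced χ (fun r ↦ ((ratPlusSymbol f r : ℚ) : ℚ_[p])) ã s‖ ≤ C := by
  set x : ℚ → ℚ_[p] := fun r ↦ ((ratPlusSymbol f r : ℚ) : ℚ_[p]) with hxdef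
  have hperx : ∀ s, x (s + 1) = x s := fun s ↦ by
    simp only [hxdef]
    rw [show (s + 1 : ℚ) = s + ((1 : ℤ) : ℚ) by push_cast; rfl, ratPlusSymbol_add_intCast_eq]
  constructor
  · rintro ⟨Φ, ã, hã, hper, hx, hU, s₁, hs₁⟩
    have hU0ℚ := CensusX43.HasOrdinaryTwistPartner.sum_ratPlusSymbol_eq_zero hχ
      ⟨Φ, ã, hã, hper, hx, hU, s₁, hs₁⟩
    refine ⟨hU0ℚ, ã, hã, ‖Φ s₁‖, fun s ↦ ?_⟩
    rw [← eq_forced_of_partner hχ hã hperx hper hx hU]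
    exact hs₁ s
  · rintro ⟨hU0ℚ, ã, hã, C, hC⟩
    have hU0 : ∀ s, ∑ d : ZMod p, x (s + (d.val : ℚ) / p) = 0 := fun s ↦ by
      simp only [hxdef]
      exact_mod_cast congrArg (fun q : ℚ ↦ (q : ℚ_[p])) (hU0ℚ s)
    obtain ⟨hper', hx', hU'⟩ := forced_isPartner hχ hã hperx hU0
    exact ⟨forced χ x ã, ã, hã, hper', hx', hU', exists_forall_norm_le_norm_of_bounded hC⟩

end Reduction

end TwistPartner

/-! ### §3 Curve level: the additive rows, and the tame branch from one boundedness statement -/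

section Curve

variable {p : ℕ} [hp : Fact p.Prime] {N : ℕ} [NeZero N] {f : CuspForm (Gamma0 N) 2}
  {χ : MulChar (ZMod p) ℚ_[p]} (W : WeierstrassCurve ℚ) [W.IsElliptic]

/-- **On an ADDITIVE row the typed input is pure boundedness**: for `E = W` additive at `p` with
newform `f` and `χ ≠ 1`, `CensusX43.HasOrdinaryTwistPartner χ f ↔ ∃ ã, ‖ã‖ = 1 ∧ Φ_{f,χ,ã}` bounded
(`U_p f = 0` is automatic: `sum_ratPlusSymbol_add_div_eq_zero_of_addv`). On the X4-3 locus
(defect `e ∈ {3,4,6}`, `χ = ω^{t(E,p)}`) this is what cc-typer-2's `OrdinaryTwistPartnerAt W p`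
asks, row by row. [cite: Delbourgo1998, §1.5] [cite: MazurTateTeitelbaum1986Invent, §I.10] -/
theorem hasOrdinaryTwistPartner_iff_of_addv (hχ : χ ≠ 1) (hf : IsNewformOf W f)
    (hadd : Addv W p) :
    CensusX43.HasOrdinaryTwistPartner χ f ↔
      ∃ ã : ℚ_[p], ‖ã‖ = 1 ∧ ∃ C : ℝ, ∀ s,
        ‖TwistPartner.forced χ (fun r ↦ ((ratPlusSymbol f r : ℚ) : ℚ_[p])) ã s‖ ≤ C := by
  rw [TwistPartner.hasOrdinaryTwistPartner_iff_bounded_forced hχ]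
  exact ⟨fun h ↦ h.2, fun h ↦ ⟨sum_ratPlusSymbol_add_div_eq_zero_of_addv W hf hadd, h⟩⟩

/-- **THE E-NORMALISED TAME BRANCH FROM ONE BOUNDEDNESS STATEMENT.** For `E = W` additive at `p` with
newform `f`, `χ ≠ 1`, and a unit `ã` such that the forced partner `Φ_{f,χ,ã}` is bounded: there is
`B ∈ ℚ_p⟦T⟧` with `IsTameBranchOf f p (ι∘χ) ã B` (bounded; `B(0) = ã⁻¹[0]⁺_f`;
`B(κ(γ)−1) = ã^{−m}p^{−1}τ(ι∘χ,ψ_κ)∑_bκ(b)[b/p^m]⁺_f`) and `‖[Tⁿ]B‖ ≤ C` for every bound `C` of the plus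
symbols of `f` (cc-typer-2's bridge `exists_isTameBranchOf_of_twistPartnerData` run on the forced
partner). On the defect-3/4/6 rows of X3♯(G-ord)/X4♯(G-ord) this inhabits the premise of
`TameBranchRatCharEqAt W p` / `TameBranchRatDvdAt W p` / the certificate consumers by ONE checkable
statement about `E`'s own symbols; by `IsTameBranchOf.tuple_eq` it is THE tame branch.
[cite: MazurTateTeitelbaum1986Invent, §I.10 and §I.14 (14.3)] [cite: Delbourgo1998, §1.5–1.6] -/
theorem exists_isTameBranchOf_of_bounded_forced (hχ : χ ≠ 1) (hf : IsNewformOf W f)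
    (hadd : Addv W p) {ã : ℚ_[p]} (hã : ‖ã‖ = 1) {C : ℝ}
    (hC : ∀ s, ‖TwistPartner.forced χ (fun r ↦ ((ratPlusSymbol f r : ℚ) : ℚ_[p])) ã s‖ ≤ C) :
    ∃ B : PowerSeries ℚ_[p], IsTameBranchOf f p (χ.ringHomComp (algebraMap ℚ_[p] ℂ_[p])) ã B ∧
      ∀ C' : ℝ, (∀ r : ℚ, ‖((ratPlusSymbol f r : ℚ) : ℚ_[p])‖ ≤ C') →
        ∀ n : ℕ, ‖PowerSeries.coeff n B‖ ≤ C' := by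
  set x : ℚ → ℚ_[p] := fun r ↦ ((ratPlusSymbol f r : ℚ) : ℚ_[p]) with hxdef
  have hperx : ∀ s, x (s + 1) = x s := fun s ↦ by
    simp only [hxdef]
    rw [show (s + 1 : ℚ) = s + ((1 : ℤ) : ℚ) by push_cast; rfl, ratPlusSymbol_add_intCast_eq]
  have hU0 : ∀ s, ∑ d : ZMod p, x (s + (d.val : ℚ) / p) = 0 :=
    sum_cast_ratPlusSymbol_add_div_eq_zero_of_addv W hf hadd
  obtain ⟨hper', hx', hU'⟩ := TwistPartner.forced_isPartner hχ hã hperx hU0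
  obtain ⟨s₁, hs₁⟩ := TwistPartner.exists_forall_norm_le_norm_of_bounded hC
  exact exists_isTameBranchOf_of_twistPartnerData hχ hã hper' hx' hU' hs₁

end Curve

/-! ### §4 The engine: the forced partner on the tower and the tame-branch measure, explicitly -/

section Engine

variable {p : ℕ} [hp : Fact p.Prime] {χ : MulChar (ZMod p) ℚ_[p]} {x : ℚ → ℚ_[p]} {ã : ℚ_[p]}

/-- **The forced partner on the `p`-power tower** (`U_p x = 0`, `χ ≠ 1`, `‖ã‖ = 1`): for `a ∈ ℤ`,
`Φ(a/pⁿ) = ∑_{j<n} (ã/p)^j·S(a/p^{n−j}) + (ã/p)ⁿ·S(0)/(1 − ã/p)`, `S = TwistPartner.source χ x` —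
`TwistPartner.apply_div_pow_eq_sum` for the partner `forced χ x ã`. A FINITE expression in the
`χ`-twisted values `∑_b χ(b)x(a/p^m + b/p)`, `m ≤ n`. [cite: MazurTateTeitelbaum1986Invent, §I.10 (10.1)] -/
theorem TwistPartner.forced_apply_div_pow_eq_sum (hχ : χ ≠ 1) (hã : ‖ã‖ = 1)
    (hperx : ∀ s, x (s + 1) = x s) (hU0 : ∀ s, ∑ d : ZMod p, x (s + (d.val : ℚ) / p) = 0)
    (a : ℤ) (n : ℕ) :
    TwistPartner.forced χ x ã (a / (p : ℚ) ^ n) =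
      ∑ j ∈ Finset.range n,
          (ã / p) ^ j * TwistPartner.source χ x (a / (p : ℚ) ^ (n - j)) +
        (ã / p) ^ n * ((1 - ã / p)⁻¹ * TwistPartner.source χ x 0) := by
  obtain ⟨hper', hx', hU'⟩ := TwistPartner.forced_isPartner hχ hã hperx hU0
  exact TwistPartner.apply_div_pow_eq_sum hχ hã hper' hx' hU' a n

/-- **THE TAME-BRANCH MEASURE, EXPLICITLY** (ENGINE RECIPE for the defect-3/4/6 rows): the measure
`χ̄·μ_Φ` of cc-typer-2's bridge (`twistPartnerMeasure`, whose Mellin transform is the E-normalised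
tame branch of `exists_isTameBranchOf_of_twistPartnerData`) evaluated on the forced partner is, at
level `n + 1` and residue `a`,
`μ(a + p^{n+1}ℤ_p) = ã^{−(n+1)}·χ̄(a)·[∑_{j≤n} (ã/p)^j·S(a/p^{n+1−j}) + (ã/p)^{n+1}·S(0)/(1 − ã/p)]`
with `S(r) = (χ(−1)/p)∑_{b mod p} χ(b)·x(r + b/p)` — for `x = [·]⁺_{f_E}` a finite sum of twisted
modular symbols of `E` itself (PARI `msfromell` currency), no newform with nebentypus needed.
[cite: MazurTateTeitelbaum1986Invent, §I.10 (10.1)] -/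
theorem TwistPartner.twistPartnerMeasure_forced_succ (hχ : χ ≠ 1) (hã : ‖ã‖ = 1)
    (hperx : ∀ s, x (s + 1) = x s) (hU0 : ∀ s, ∑ d : ZMod p, x (s + (d.val : ℚ) / p) = 0)
    (x₀ : ℚ_[p]) (n : ℕ) (a : ZMod (p ^ (n + 1))) :
    twistPartnerMeasure χ (TwistPartner.forced χ x ã) ã x₀ (n + 1) a =
      ã⁻¹ ^ (n + 1) * χ⁻¹ ((a.val : ℕ) : ZMod p) *
        (∑ j ∈ Finset.range (n + 1),
            (ã / p) ^ j * TwistPartner.source χ x ((a.val : ℤ) / (p : ℚ) ^ (n + 1 - j)) +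
          (ã / p) ^ (n + 1) * ((1 - ã / p)⁻¹ * TwistPartner.source χ x 0)) := by
  rw [twistPartnerMeasure_succ, ← TwistPartner.forced_apply_div_pow_eq_sum hχ hã hperx hU0]
  push_cast
  rfl

end Engine

end Summit.BirchSwinnertonDyer.Rank1Residual.Additive

end
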